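import Summits.CriticalPhenomena.PercolationContinuityZ3.Theorems.PercNearOneGluingNoHeavyLowerTailCSHPsiLevelForms
import Summits.CriticalPhenomena.PercolationContinuityZ3.Theorems.PercNearOneGluingNoHeavyLowerTailCSHPsiLemmaT
import Summits.CriticalPhenomena.PercolationContinuityZ3.Theorems.PercNearOneGluingNoHeavyLowerTailCSHUnfoldDecoy
import Summits.CriticalPhenomena.PercolationContinuityZ3.Theorems.PercNearOneGluingNoHeavyLowerTailCovTauBridge
import HarnessLib

/-!
# Pinned hierarchy (PIN-CSH), Lemma U_ψ for general `k`: the world term of ONE decoy in the PINNED ROW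

Support file (`--supports stmt-CriticalPhenomena-4575`), route task `nh-dp-fatminority` (line fat-minority-linear, gen 16); memo
`run/shared/lean/prim/prim-nh-dp-fatminority/CSH-PSI-MEMO.md` §2 (Lemma U_ψ).  Fifth brick of the Lean proof of memo THEOREM 1_ψ
(`PinCSH.Holds`).  No definitions, no named facts, no sorries.  Sum level (`BHK2006.weight`, `Σ weight = 1`), worlds = delete the pairs meeting
`Y ∪ V(C_Y(ω))` (`HullPort.cut Y ω`), in the vocabulary of prim-ineq-prove-1's pure one-decoy file `…CSHUnfoldDecoy.lean` (`CSH.resid`,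
`CSH.phiS`, `CSH.world_term_alive/dead`, `CSH.sum_resid_mul_clusterFn`) and of the pinned level-form algebra `PinCSH.prel` (`…CSHPsiLevelForms.lean`).

THE PINNED ROW.  Owner `x`, avoided set `Y`, source set `S ∋ x`, decoy `d ∉ S` with `d ≠ o`, later decoys `L'` (none equal to `d`), label `o`
with the upper family `𝓗`.  In the world configuration `β` the pinned row relation is `prel R_β Hc_β o` with `R_β` = open reachability in `β`
and the pinned predicate `Hc_β(u) ⟺ u ↔_β o ∧ C_u(β) ∈ 𝓗`; the `d`-term of the pinned-row unfolding (`CSH.unfoldT (prel …)` at `u = o`) is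
`ε(d)·sl_{L'}[χ^{prel}_d − c](o)` whose entry at `o` is the pinned test `ψ(C_d) = 1{d ↔ o}·1{C_d ∈ 𝓗}` of the world.  THIS FILE proves
(`PinCSH.decoy_world_term_pin`), exactly as the pure `CSH.decoy_world_term`:

  `Σ_ω w(ω) 1{x↮Y}(ω) · Cov_{world(ω)}( g(C_x), ε(d)·sl_{L'}[χ^{prel}_d − c](o) )  =  −m₀⁻¹ · sl_{L'}[ w' ↦ m₀·P₁(w') − m₁(w')·P₀ ](o)`,

`E = {d ↮ S ∪ Y}`, `m₀ = μ(E)`, and at a ROW `w'` the masses/moments are those of the row's TEST EVENT `T(w')` — `{d ↔ w'}` for a vertex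
`w' ≠ o` and `pinEv o 𝓗 d` at the label: `m₁(w') = μ(E ∩ T(w'))`, `P₁(w') = Σ w 1_{E∩T(w')} Φ(C_d)`, `P₀ = Σ w 1_E Φ(C_d)`, `c = m₁/m₀` (the
pinned decoy constant `PinCSH.pAvoidConst`).  No remainder term arises: the pinned test IS a function of `C_d` (memo §2: "`ψ(C_{d_j})` is
`σ(C_{d_j})`-measurable").  Steps: Markov merge at `C_Y` (`CSH.markov_merge_Y`); alive decoy ⇒ world tests = global tests, including the pinned
one (`world_term_alive_pin`: the cluster and the connections of a decoy avoiding `Y` are unchanged in the world); dead decoy ⇒ all entries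
vanish, the term is configuration-free (`world_term_dead_pin`) and dies against the residual (`CSH.residual_orthogonal`); linearity of
`sl_{L'}`; Markov at `C_d` + Lemma Φ(a) for a general test event read on `C_d` (`sum_resid_event_moment`, from `CSH.sum_resid_mul_clusterFn`).
[cite: VandenbergHaggstromKahn2005, §2.1 Lemma 2.4 (p. 10); §1 display (10) (pp. 7–8) — corollaries] [cite: KozmaNitzan2024, Question 7 (p. 36)]
-/

noncomputable section

namespace Summit.CriticalPhenomena.PercolationContinuityZ3.Theorems

open MeasureTheory Set Literature.Probability.LatticeModels Literature.Probability.Percolation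
open scoped Classical
open BHK2006 DecisionTree HullPort CSH

namespace PinCSH

variable {V : Type*}

/-! ### The pinned `d`-term read in the world: alive and dead decoys -/

/-- **Alive decoy, pinned row**: if `d ↮ Y` in `ζ` (and `d ≠ o`), the pinned-row world term `ε(d)·sl_{L'}[χ^{prel}_d − c](o)` in the world
`ζ ∖ cut_Y ζ` equals `1{d ↮ S}(ζ) · sl_{L'}[w' ↦ 1_{T(w')}(ζ) − c(w')](o)` with the GLOBAL tests `T(w') = {d ↔ w'}` (`w' ≠ o`) and
`T(o) = pinEv o 𝓗 d` (the cluster and the connections of `d` are the same in the world and in `ζ`).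
(transcription of the memo prim-nh-dp-fatminority CSH-PSI-MEMO.md §2 Lemma U_ψ) [folklore] -/
theorem world_term_alive_pin {ζ : Set (Sym2 V)} {Y : Set V} {d : V} (h : ζ ∈ avoidEv d Y) (S : Set V) (o : V)
    (𝓗 : Set (Set (Sym2 V))) (hdo : d ≠ o) (L' : List (V × (V → ℝ))) (c : V → ℝ) :
    av (prel (openGraph (ζ \ cut Y ζ)).Reachable
          (fun u => (openGraph (ζ \ cut Y ζ)).Reachable u o ∧ openEdgeCluster (ζ \ cut Y ζ) u ∈ 𝓗) o) S d *
        slForm L' (fun w' => chi (prel (openGraph (ζ \ cut Y ζ)).Reachable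
          (fun u => (openGraph (ζ \ cut Y ζ)).Reachable u o ∧ openEdgeCluster (ζ \ cut Y ζ) u ∈ 𝓗) o) w' d - c w') o =
      ind (avoidEv d S) ζ * slForm L' (fun w' =>
        ind (if w' = o then pinEv o 𝓗 d else (openConn d w' : Set (BondConfig V))) ζ - c w') o := by
  have hfun : (fun w' => chi (prel (openGraph (ζ \ cut Y ζ)).Reachable
        (fun u => (openGraph (ζ \ cut Y ζ)).Reachable u o ∧ openEdgeCluster (ζ \ cut Y ζ) u ∈ 𝓗) o) w' d - c w') =
      fun w' => ind (if w' = o then pinEv o 𝓗 d else (openConn d w' : Set (BondConfig V))) ζ - c w' := by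
    funext w'
    by_cases hw' : w' = o
    · subst hw'
      rw [chi_prel_label, if_pos rfl]
      have e : ((openGraph (ζ \ cut Y ζ)).Reachable d w' ∧ openEdgeCluster (ζ \ cut Y ζ) d ∈ 𝓗) ↔ ζ ∈ pinEv w' 𝓗 d := by
        rw [reachable_sdiff_cut_iff_of_avoid h w', openEdgeCluster_sdiff_cut_of_avoid h]
        rfl
      unfold ind
      rw [propext e]
    · rw [chi_prel_of_ne _ _ _ hw', if_neg hw', ← chi_reachable_eq_ind ζ w' d]
      unfold CSH.chi
      rw [show ((openGraph (ζ \ cut Y ζ)).Reachable w' d) = ((openGraph ζ).Reachable w' d) from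
        propext (reachable_world_iff_of_alive h w')]
  have hav : av (prel (openGraph (ζ \ cut Y ζ)).Reachable
        (fun u => (openGraph (ζ \ cut Y ζ)).Reachable u o ∧ openEdgeCluster (ζ \ cut Y ζ) u ∈ 𝓗) o) S d = ind (avoidEv d S) ζ := by
    rw [av_prel _ _ _ S hdo, ← av_reachable_eq_ind ζ S d]
    unfold av
    have : (∀ s ∈ S, ¬ (openGraph (ζ \ cut Y ζ)).Reachable d s) ↔ (∀ s ∈ S, ¬ (openGraph ζ).Reachable d s) :=
      forall₂_congr fun s _ => by rw [reachable_sdiff_cut_iff_of_avoid h s]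
    rw [show (∀ s ∈ S, ¬ (openGraph (ζ \ cut Y ζ)).Reachable d s) = (∀ s ∈ S, ¬ (openGraph ζ).Reachable d s) from
      propext this]
  rw [hfun, hav]

/-- **Dead decoy, pinned row**: if `d ↔ Y` in `ζ`, the pinned-row world term is the CONFIGURATION-FREE number `−sl_{L'}[c](o)` (for `d ∉ S`,
`d ≠ o`, `d` not among the later decoys): `d` is isolated in the world, so no vertex and no pinned test sees it.
(transcription of the memo prim-nh-dp-fatminority CSH-PSI-MEMO.md §2 Lemma U_ψ, "if o ∈ W … no convention needed") [folklore] -/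
theorem world_term_dead_pin {ζ : Set (Sym2 V)} {Y : Set V} {d : V} (h : ζ ∉ avoidEv d Y) {S : Set V} (hdS : d ∉ S) (o : V)
    (𝓗 : Set (Set (Sym2 V))) (hdo : d ≠ o) (L' : List (V × (V → ℝ))) (hL' : ∀ dc ∈ L', dc.1 ≠ d) (c : V → ℝ) :
    av (prel (openGraph (ζ \ cut Y ζ)).Reachable
          (fun u => (openGraph (ζ \ cut Y ζ)).Reachable u o ∧ openEdgeCluster (ζ \ cut Y ζ) u ∈ 𝓗) o) S d *
        slForm L' (fun w' => chi (prel (openGraph (ζ \ cut Y ζ)).Reachable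
          (fun u => (openGraph (ζ \ cut Y ζ)).Reachable u o ∧ openEdgeCluster (ζ \ cut Y ζ) u ∈ 𝓗) o) w' d - c w') o =
      - slForm L' c o := by
  have hav : av (prel (openGraph (ζ \ cut Y ζ)).Reachable
      (fun u => (openGraph (ζ \ cut Y ζ)).Reachable u o ∧ openEdgeCluster (ζ \ cut Y ζ) u ∈ 𝓗) o) S d = 1 := by
    rw [av_prel _ _ _ S hdo]
    unfold av
    rw [if_pos]
    intro s hs hr
    rw [SimpleGraph.reachable_comm, reachable_world_iff_of_dead h s] at hr
    exact hdS (hr ▸ hs)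
  have hchi : ∀ w', w' ≠ d → chi (prel (openGraph (ζ \ cut Y ζ)).Reachable
      (fun u => (openGraph (ζ \ cut Y ζ)).Reachable u o ∧ openEdgeCluster (ζ \ cut Y ζ) u ∈ 𝓗) o) w' d = 0 := by
    intro w' hw'
    by_cases hw'o : w' = o
    · subst hw'o
      rw [chi_prel_label, if_neg]
      rintro ⟨hr, -⟩
      exact hdo ((reachable_world_iff_of_dead h w').1 hr.symm).symm
    · rw [chi_prel_of_ne _ _ _ hw'o]
      unfold CSH.chi
      rw [if_neg (fun hr => hw' ((reachable_world_iff_of_dead h w').1 hr))]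
  have hsl : slForm L' (fun w' => chi (prel (openGraph (ζ \ cut Y ζ)).Reachable
        (fun u => (openGraph (ζ \ cut Y ζ)).Reachable u o ∧ openEdgeCluster (ζ \ cut Y ζ) u ∈ 𝓗) o) w' d - c w') o =
      slForm L' (fun w' => (-1 : ℝ) • c w') o := by
    refine slForm_congr L' ?_ fun dc hdc => ?_
    · rw [hchi o hdo.symm]; simp
    · rw [hchi dc.1 (hL' dc hdc)]; simp
  rw [hav, one_mul, hsl, show (fun w' => (-1 : ℝ) • c w') = (-1 : ℝ) • c from rfl, slForm_smul, Pi.smul_apply,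
    smul_eq_mul]
  ring

/-! ### Centring at the decoy constant, for a general test event read on the cluster of the decoy -/

variable [Fintype V]

/-- **The centred decoy moment for a general test event** `T` read on the open edge cluster of `d` (`τ(C_d(ζ)) = 1_T(ζ)`): with
`E = {d ↮ A}` (`A ⊇ {x} ∪ Y`), `m₀ = μ(E) ≠ 0`, `m₁ = μ(E ∩ T)`, `c = m₁/m₀`, `P₁ = Σ w 1_{E∩T} Φ(C_d)`, `P₀ = Σ w 1_E Φ(C_d)`:
`Σ_ζ w Θ·1_E·(1_T − c) = −m₀⁻¹·(m₀ P₁ − m₁ P₀)` (`CSH.sum_resid_decoy_moment` is `T = {d ↔ w'}`).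
(transcription of the memo prim-nh-dp-fatminority CSH-PSI-MEMO.md §2 Lemma U_ψ, "`E_{ρ_j}[Θ(ψ(C_{d_j}) − c_j(ψ))] = Cov_{ρ_j}(θ, ψ)`")
[cite: VandenbergHaggstromKahn2005, §2.1 Lemma 2.4 (p. 10) — corollary] -/
theorem sum_resid_event_moment (w : Sym2 V → ℝ) (hm : ∑ ω, weight w ω = 1) (x : V) (Y : Set V)
    (g : Set (Sym2 V) → ℝ) (d : V) {A : Set V} (hA : insert x Y ⊆ A) (T : Set (BondConfig V)) (τ : Set (Sym2 V) → ℝ)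
    (hτ : ∀ ζ : Set (Sym2 V), τ (openEdgeCluster ζ d) = ind T ζ) {c : ℝ}
    (hm₀ : ∑ ζ, weight w ζ * ind (avoidEv d A) ζ ≠ 0)
    (hc : c = (∑ ζ, weight w ζ * ind (avoidEv d A ∩ T) ζ) / ∑ ζ, weight w ζ * ind (avoidEv d A) ζ) :
    ∑ ζ, weight w ζ * (resid w x Y g ζ * (ind (avoidEv d A) ζ * (ind T ζ - c))) =
      - ((∑ ζ, weight w ζ * ind (avoidEv d A) ζ)⁻¹ *
          ((∑ ζ, weight w ζ * ind (avoidEv d A) ζ) *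
              (∑ ζ, weight w ζ * (ind (avoidEv d A ∩ T) ζ * phiS w x Y g d ζ)) -
            (∑ ζ, weight w ζ * ind (avoidEv d A ∩ T) ζ) *
              (∑ ζ, weight w ζ * (ind (avoidEv d A) ζ * phiS w x Y g d ζ)))) := by
  set f : Set (Sym2 V) → ℝ := fun K => τ K - c with hf
  have hfK : ∀ ζ : Set (Sym2 V), f (openEdgeCluster ζ d) = ind T ζ - c := by
    intro ζ; simp only [hf, hτ]
  have h1 := sum_resid_mul_clusterFn w hm x Y g d hA f
  simp only [hfK] at h1
  rw [h1]
  set m₀ := ∑ ζ, weight w ζ * ind (avoidEv d A) ζ with hm₀'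
  set m₁ := ∑ ζ, weight w ζ * ind (avoidEv d A ∩ T) ζ with hm₁'
  set P₁ := ∑ ζ, weight w ζ * (ind (avoidEv d A ∩ T) ζ * phiS w x Y g d ζ) with hP₁
  set P₀ := ∑ ζ, weight w ζ * (ind (avoidEv d A) ζ * phiS w x Y g d ζ) with hP₀
  have e : ∑ ζ, weight w ζ * (ind (avoidEv d A) ζ * (ind T ζ - c) * phiS w x Y g d ζ) = P₁ - c * P₀ := by
    rw [hP₁, hP₀, Finset.mul_sum, ← Finset.sum_sub_distrib]
    refine Finset.sum_congr rfl fun ζ _ => ?_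
    rw [ind_inter]; ring
  rw [e, hc]
  field_simp

/-- **The pinned rows' test events are read on the edge cluster of the decoy**: with `T(w') = {d ↔ w'}` for `w' ≠ o` and `T(o) = pinEv o 𝓗 d`,
`τ_{w'}(C_d(ζ)) = 1_{T(w')}(ζ)` for the cluster functionals `τ_{w'}(K) = 1{w' = d ∨ w' ∈ V(K)}` / `τ_o(K) = 1{(o = d ∨ o ∈ V(K)) ∧ K ∈ 𝓗}`.
[folklore] -/
theorem pinRow_cluster (o : V) (𝓗 : Set (Set (Sym2 V))) (d w' : V) (ζ : Set (Sym2 V)) :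
    (fun K : Set (Sym2 V) => if w' = o then (if ((o = d ∨ ∃ e ∈ K, o ∈ e) ∧ K ∈ 𝓗) then (1 : ℝ) else 0)
        else (if (w' = d ∨ ∃ e ∈ K, w' ∈ e) then (1 : ℝ) else 0)) (openEdgeCluster ζ d) =
      ind (if w' = o then pinEv o 𝓗 d else (openConn d w' : Set (BondConfig V))) ζ := by
  by_cases hw' : w' = o
  · simp only [hw', if_true]
    rw [pinnedRow_openEdgeCluster o 𝓗 d ζ, ← CovTau.ind_eq_indicator_one]
  · simp only [hw', if_false]
    rw [ind_openConn_eq_ite_cluster]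

/-! ### The world term of one decoy in the pinned row -/

/-- **THE WORLD TERM OF ONE DECOY IN THE PINNED ROW** (memo §2 Lemma U_ψ, the `j`-th term at the label before the `o − p·v` combination).
Data: owner `x`, avoided set `Y`, source set `S ∋ x`, decoy `d ∉ S` with `d ≠ o`, later decoys `L'` (none equal to `d`), label `o`, upper
family `𝓗`, `E = {d ↮ S ∪ Y}`, `m₀ = μ(E) ≠ 0`, and the pinned constants `c(w') = μ(E ∩ T(w'))/m₀` (`T(w') = {d ↔ w'}` for `w' ≠ o`,
`T(o) = pinEv o 𝓗 d`).  Then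
`Σ_ω w 1{x↮Y} Cov_{world(ω)}(g(C_x), ε(d)·sl_{L'}[χ^{prel}_d − c](o)) = −m₀⁻¹ · sl_{L'}[w' ↦ m₀·P₁(T w') − m₁(T w')·P₀](o)`.
(transcription of the memo prim-nh-dp-fatminority CSH-PSI-MEMO.md §2 Lemma U_ψ, contribution of one decoy to the ψ-row)
[cite: VandenbergHaggstromKahn2005, §2.1 Lemma 2.4 (p. 10); §1 display (10) (pp. 7–8) — corollaries] -/
theorem decoy_world_term_pin (w : Sym2 V → ℝ) (hm : ∑ ω, weight w ω = 1) (x : V) (Y : Set V) (g : Set (Sym2 V) → ℝ)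
    {S : Set V} (hxS : x ∈ S) {d : V} (hdS : d ∉ S) (o : V) (𝓗 : Set (Set (Sym2 V))) (hdo : d ≠ o)
    (L' : List (V × (V → ℝ))) (hL' : ∀ dc ∈ L', dc.1 ≠ d) (c : V → ℝ)
    (hm₀ : ∑ ζ, weight w ζ * ind (avoidEv d (S ∪ Y)) ζ ≠ 0)
    (hc : ∀ w', c w' = (∑ ζ, weight w ζ *
        ind (avoidEv d (S ∪ Y) ∩ (if w' = o then pinEv o 𝓗 d else (openConn d w' : Set (BondConfig V)))) ζ) /
      ∑ ζ, weight w ζ * ind (avoidEv d (S ∪ Y)) ζ) :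
    ∑ ω, weight w ω * (ind (avoidEv x Y) ω *
        wcovOff w Y (fun β => g (openEdgeCluster β x))
          (fun ζ => av (prel (openGraph ζ).Reachable (fun u => (openGraph ζ).Reachable u o ∧ openEdgeCluster ζ u ∈ 𝓗) o) S d *
            slForm L' (fun w' => chi (prel (openGraph ζ).Reachable
              (fun u => (openGraph ζ).Reachable u o ∧ openEdgeCluster ζ u ∈ 𝓗) o) w' d - c w') o) ω) =
      - ((∑ ζ, weight w ζ * ind (avoidEv d (S ∪ Y)) ζ)⁻¹ *
          slForm L' (fun w' =>
            (∑ ζ, weight w ζ * ind (avoidEv d (S ∪ Y)) ζ) *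
                (∑ ζ, weight w ζ * (ind (avoidEv d (S ∪ Y) ∩
                  (if w' = o then pinEv o 𝓗 d else (openConn d w' : Set (BondConfig V)))) ζ * phiS w x Y g d ζ)) -
              (∑ ζ, weight w ζ * ind (avoidEv d (S ∪ Y) ∩
                  (if w' = o then pinEv o 𝓗 d else (openConn d w' : Set (BondConfig V)))) ζ) *
                (∑ ζ, weight w ζ * (ind (avoidEv d (S ∪ Y)) ζ * phiS w x Y g d ζ))) o) := by
  classical
  have hA : insert x Y ⊆ S ∪ Y := by
    intro a ha
    rcases mem_insert_iff.1 ha with rfl | ha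
    · exact Or.inl hxS
    · exact Or.inr ha
  set G : Set (Sym2 V) → ℝ := fun β => g (openEdgeCluster β x) with hG
  set T : V → Set (BondConfig V) := fun w' => if w' = o then pinEv o 𝓗 d else (openConn d w' : Set (BondConfig V)) with hT
  set ψ : Set (Sym2 V) → ℝ := fun ζ =>
    av (prel (openGraph ζ).Reachable (fun u => (openGraph ζ).Reachable u o ∧ openEdgeCluster ζ u ∈ 𝓗) o) S d *
      slForm L' (fun w' => chi (prel (openGraph ζ).Reachable
        (fun u => (openGraph ζ).Reachable u o ∧ openEdgeCluster ζ u ∈ 𝓗) o) w' d - c w') o with hψ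
  -- abbreviations for the right-hand side
  set m₀ := ∑ ζ, weight w ζ * ind (avoidEv d (S ∪ Y)) ζ with hm₀'
  set Q : V → ℝ := fun w' =>
    m₀ * (∑ ζ, weight w ζ * (ind (avoidEv d (S ∪ Y) ∩ T w') ζ * phiS w x Y g d ζ)) -
      (∑ ζ, weight w ζ * ind (avoidEv d (S ∪ Y) ∩ T w') ζ) *
        (∑ ζ, weight w ζ * (ind (avoidEv d (S ∪ Y)) ζ * phiS w x Y g d ζ)) with hQ
  -- Step 1: world covariance as a centred world mean, and the Markov merge at `C_Y`
  have step1 : ∑ ω, weight w ω * (ind (avoidEv x Y) ω * wcovOff w Y G ψ ω) =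
      ∑ ζ, weight w ζ * (resid w x Y g ζ * ψ (ζ \ cut Y ζ)) := by
    have h := markov_merge_Y w hm x Y g ψ
    have lhs : ∀ ω, weight w ω * (ind (avoidEv x Y) ω * wcovOff w Y G ψ ω) =
        weight w ω * (ind (avoidEv x Y) ω * ∑ η, weight w η * ((g (openEdgeCluster (η \ cut Y ω) x) -
          wmeanOff w Y (fun β => g (openEdgeCluster β x)) ω) * ψ (η \ cut Y ω))) := by
      intro ω; rw [wcovOff_eq_sum]
    rw [Finset.sum_congr rfl (fun ω _ => lhs ω), h]
    refine Finset.sum_congr rfl fun ζ _ => ?_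
    unfold resid; ring
  -- Step 2: the world test function in the merged configuration (alive / dead decoy)
  have step2 : ∀ ζ, ψ (ζ \ cut Y ζ) =
      ind (avoidEv d (S ∪ Y)) ζ * slForm L' (fun w' => ind (T w') ζ - c w') o +
        (1 - ind (avoidEv d Y) ζ) * (- slForm L' c o) := by
    intro ζ
    by_cases h : ζ ∈ avoidEv d Y
    · rw [hψ]
      dsimp only
      rw [world_term_alive_pin h S o 𝓗 hdo L' c, ← ind_avoidEv_mul_union d S Y ζ, ind_of_mem h]
      simp only [hT]
      ring
    · rw [hψ]
      dsimp only
      rw [world_term_dead_pin h hdS o 𝓗 hdo L' hL' c, ind_of_not_mem h]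
      have h0 : ind (avoidEv d (S ∪ Y)) ζ = 0 := ind_of_not_mem fun h' => h fun y hy => h' y (Or.inr hy)
      rw [h0]; ring
  -- Step 3: the dead part dies against the residual
  have step3 : ∑ ζ, weight w ζ * (resid w x Y g ζ * ((1 - ind (avoidEv d Y) ζ) * (- slForm L' c o))) = 0 := by
    have h := residual_orthogonal w hm x Y g
      (fun W => (1 - (if (d ∈ Y ∨ ∃ e ∈ W, d ∈ e) then (0 : ℝ) else 1)) * (- slForm L' c o))
    rw [← h]
    refine Finset.sum_congr rfl fun ζ _ => ?_
    unfold resid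
    rw [one_sub_ind_avoidEv_eq d Y ζ]; ring
  -- Step 4: the alive part, by linearity of `sl_{L'}` and the centred decoy moments (general test events)
  have step4 : ∑ ζ, weight w ζ * (resid w x Y g ζ * (ind (avoidEv d (S ∪ Y)) ζ *
      slForm L' (fun w' => ind (T w') ζ - c w') o)) = - (m₀⁻¹ * slForm L' Q o) := by
    have lin : ∀ ζ, slForm L' (fun w' => ind (T w') ζ - c w') o =
        ∑ w', slForm L' (Pi.single w' (1 : ℝ)) o * (ind (T w') ζ - c w') :=
      fun ζ => slForm_eq_sum_single L' _ o
    simp only [lin, Finset.mul_sum]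
    rw [Finset.sum_comm]
    have inner : ∀ w', ∑ ζ, weight w ζ * (resid w x Y g ζ * (ind (avoidEv d (S ∪ Y)) ζ *
        (slForm L' (Pi.single w' (1 : ℝ)) o * (ind (T w') ζ - c w')))) =
        slForm L' (Pi.single w' (1 : ℝ)) o * (- (m₀⁻¹ * Q w')) := by
      intro w'
      rw [← sum_resid_event_moment w hm x Y g d hA (T w')
        (fun K : Set (Sym2 V) => if w' = o then (if ((o = d ∨ ∃ e ∈ K, o ∈ e) ∧ K ∈ 𝓗) then (1 : ℝ) else 0)
          else (if (w' = d ∨ ∃ e ∈ K, w' ∈ e) then (1 : ℝ) else 0))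
        (fun ζ => pinRow_cluster o 𝓗 d w' ζ) hm₀ (hc w'), Finset.mul_sum]
      exact Finset.sum_congr rfl fun ζ _ => by ring
    rw [Finset.sum_congr rfl (fun w' _ => inner w'), slForm_eq_sum_single L' Q o, Finset.mul_sum, ← Finset.sum_neg_distrib]
    exact Finset.sum_congr rfl fun w' _ => by ring
  -- assemble
  rw [step1]
  have split : ∀ ζ, weight w ζ * (resid w x Y g ζ * ψ (ζ \ cut Y ζ)) =
      weight w ζ * (resid w x Y g ζ * (ind (avoidEv d (S ∪ Y)) ζ *
        slForm L' (fun w' => ind (T w') ζ - c w') o)) +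
      weight w ζ * (resid w x Y g ζ * ((1 - ind (avoidEv d Y) ζ) * (- slForm L' c o))) := by
    intro ζ; rw [step2 ζ]; ring
  rw [Finset.sum_congr rfl (fun ζ _ => split ζ), Finset.sum_add_distrib, step3, step4, add_zero]

end PinCSH

end Summit.CriticalPhenomena.PercolationContinuityZ3.Theorems

end
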